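import Mathlib
import Literature.AlgebraicGeometry.Resolution.CobordantBlowupRegularCentre
import Literature.AlgebraicGeometry.Resolution.CobordantBlowupExtReesBridge
import Literature.AlgebraicGeometry.Resolution.FormalNormalCrossingsAlgebra
import Summits.ResolutionOfSingularities.ResolutionOfSingularities.Theorems.WeightedInvariantHypersurfaceCentreAlgebraize
import HarnessLib

/-!
# The e.f.t. local weighted game (door `HypersurfaceCentreConstruction`): Newton faces and steepening

Topic: `Summits/ResolutionOfSingularities/ResolutionOfSingularities/Theorems`. Helper for the door item
`HypersurfaceCentreConstruction` (statement `stmt-ResolutionOfSingularities-19897`, route `WeightedInvariant`),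
line `local-engine` of `res-L1-w43-plan-1` (L W4.3), ORDER (o13) «the `dim S = 2` rung of H2a′» held by
res-type-098: kernel **K5 «Newton data + steepening»** of the design memo `L/res-type-098-w43/EFT-DIM2-DESIGN.md`
(sha16 `57346d14bde74e12`, §2 cases C/D/D′, §4 row K5), PART 1 = the DEF-FREE `J_b`-interface proposed by the reserve
hand res-type-078 (STATUS 2026-08-27T06:44Z), accepted by res-type-098 (07:07:16Z «K5: YOURS … accepted as is») and adopted
by res-L1-w43-plan-1 RULING gen 8 #3 (K5 PART 2 `…EFTDimTwoNewton`, the Δ-expansion currency, is res-type-092's); it feeds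
K6 (`…EFTDimTwoContact`, p505670) and K3a (`LocalGameEFTPointMove`, p507345).

[OURS · L1 W4.3] Replaces the role of NO printed item; NOT a statement of the manuscript
[claim: Hironaka2017, status: under-review]. AI work, weaker than expert review.

## Content (weights `(1, b)` on a pair `(x, y)`; `J_b(n) := weightedMonomialIdeal ![x, y] ![1, b] n`)

* (K5a) `weightedMonomialIdeal_steepen_eq`, `span_pair_steepen_eq` — STEEPENING `y ↦ y - c·x^b` changes neither
  the filtration `J_b` nor the ideal `(x, y)` (jets lemma, tree `weightedMonomialIdeal_eq_of_forall_sub_mem`).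
* (K5b) `exists_face` — FACE EXTRACTION: `f ∈ J_b(bν)` ⇒ `f ≡ Σ_{j ≤ ν} a_j x^{b(ν-j)} y^j (mod J_b(bν+1))`.
* (K5c) `face_coeff_mem_maximalIdeal` — FACE UNIQUENESS mod `𝔪` in a two-dimensional regular local ring with
  `(x, y) = 𝔪` (weighted quasi-regularity, tree `weightedQuasiRegular_of_linearIndependent_toCotangent`): a face
  lying in `J_b(bν+1)` has all its coefficients in `𝔪`; so the FACE POLYNOMIAL `Σ ā_j s^j ∈ κ[s]` is well defined.
* (K5d) `sub_mul_steepen_pow_mem_of_face`, `exists_steepen_of_face_eq_pow` — a `ν`-TH-POWER FACE `c̄ (s - λ̄)^ν`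
  is killed by the steepening `y' = y - λ̃ x^b`: `f ≡ c·y'^ν (mod J_b(bν+1))` with `c` a unit (case D′ of the memo).
* (K5e) glue: `maximalIdeal_mul_le`, `weightedMonomialIdeal_one_eq_pow` (`J_1(n) = 𝔪^n`),
  `weightedMonomialIdeal_le_span_pair` (`J_b(bν) ⊆ (y^ν, x^b)`), `weightedMonomialIdeal_le_span_sup_pow`
  (`J_b(bν) ⊆ (y^ν) + 𝔪^b`, the hypothesis shape of K6), `not_mem_sq_of_span_pair_eq` (`x, y ∉ 𝔪²`).

## References

* J. Włodarczyk, *Functorial resolution by torus actions*, arXiv:2203.03090, Lemma 2.1.12, §2.3.9. [Wlodarczyk2022]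
* H. Matsumura, *Commutative Ring Theory*, Thm. 16.2 (quasi-regularity), Thm. 14.2. [Matsumura1987]
-/

noncomputable section

open IsLocalRing Literature.AlgebraicGeometry.Resolution

set_option linter.dupNamespace false -- mandated namespace of this single-conjunct summit

namespace Summit.ResolutionOfSingularities.ResolutionOfSingularities.Theorems

namespace LocalGameEFTSteepening

universe u

variable {S : Type u} [CommRing S]

/-! ### Monomials of the face -/

/-- The face monomial `x^{b(ν-j)} y^j` (`j ≤ ν`) has `(1,b)`-weight `bν`. [cite: Wlodarczyk2022, Lemma 2.1.12] -/
theorem faceMonomial_mem (x y : S) (b ν : ℕ) {j : ℕ} (hj : j ≤ ν) :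
    x ^ (b * (ν - j)) * y ^ j ∈ weightedMonomialIdeal ![x, y] ![1, b] (b * ν) := by
  have h := prod_pow_mem_weightedMonomialIdeal ![x, y] ![1, b] (n := b * ν) ![b * (ν - j), j] (by
    simp only [Fin.sum_univ_two, Matrix.cons_val_zero, Matrix.cons_val_one, one_mul]
    have : b * (ν - j) + b * j = b * ν := by
      rw [← Nat.mul_add, Nat.sub_add_cancel hj]
    omega)
  simpa [Fin.prod_univ_two] using h

/-- `x ∈ J_b(1)`. [cite: Wlodarczyk2022, Lemma 2.1.12] -/
theorem fst_mem_one (x y : S) (b : ℕ) : x ∈ weightedMonomialIdeal ![x, y] ![1, b] 1 := by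
  simpa using self_mem_weightedMonomialIdeal ![x, y] ![1, b] 0

/-- `y ∈ J_b(b)`. [cite: Wlodarczyk2022, Lemma 2.1.12] -/
theorem snd_mem (x y : S) (b : ℕ) : y ∈ weightedMonomialIdeal ![x, y] ![1, b] b := by
  simpa using self_mem_weightedMonomialIdeal ![x, y] ![1, b] 1

/-- `x^k ∈ J_b(k)`. [cite: Wlodarczyk2022, Lemma 2.1.12] -/
theorem fst_pow_mem (x y : S) (b k : ℕ) : x ^ k ∈ weightedMonomialIdeal ![x, y] ![1, b] k := by
  simpa using pow_mem_weightedMonomialIdeal ![x, y] ![1, b] (fst_mem_one x y b) k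
/-! ### (K5a) Steepening does not change the filtration -/

/-- **(K5a) Steepening invariance of the weighted filtration**: `J_b(n)(x, y - c x^b) = J_b(n)(x, y)` for all
`n` (the perturbation `c x^b` has weight `b`). [cite: Wlodarczyk2022, Lemma 2.1.12] -/
theorem weightedMonomialIdeal_steepen_eq (x y c : S) (b n : ℕ) :
    weightedMonomialIdeal ![x, y - c * x ^ b] ![1, b] n = weightedMonomialIdeal ![x, y] ![1, b] n := by
  refine weightedMonomialIdeal_eq_of_forall_sub_mem ![x, y] ![x, y - c * x ^ b] ![1, b]
    (Fin.forall_fin_two.2 ⟨?_, ?_⟩) (Fin.forall_fin_two.2 ⟨?_, ?_⟩) n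
  · simp
  · simpa using neg_mem (Ideal.mul_mem_left _ c (fst_pow_mem x y b b))
  · simp
  · simpa using Ideal.mul_mem_left _ c (fst_pow_mem x (y - c * x ^ b) b b)

/-- Steepening does not change the ideal `(x, y)`: `(x, y - c x^b) = (x, y)` for `b ≥ 1`. [folklore] -/
theorem span_pair_steepen_eq (x y c : S) {b : ℕ} (hb : 1 ≤ b) :
    Ideal.span {x, y - c * x ^ b} = Ideal.span {x, y} := by
  obtain ⟨b', rfl⟩ := Nat.exists_eq_add_of_le hb
  apply le_antisymm
  · rw [Ideal.span_le, Set.insert_subset_iff, Set.singleton_subset_iff]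
    exact ⟨Ideal.subset_span (by simp), Ideal.mem_span_pair.2 ⟨-(c * x ^ b'), 1, by ring⟩⟩
  · rw [Ideal.span_le, Set.insert_subset_iff, Set.singleton_subset_iff]
    exact ⟨Ideal.subset_span (by simp), Ideal.mem_span_pair.2 ⟨c * x ^ b', 1, by ring⟩⟩
/-! ### (K5e) Glue lemmas -/

/-- `(x, y)^k ⊆ J_b(k)` when `b ≥ 1`. [cite: Wlodarczyk2022, Lemma 2.1.12] -/
theorem span_pair_pow_le (x y : S) {b : ℕ} (hb : 1 ≤ b) (k : ℕ) :
    Ideal.span {x, y} ^ k ≤ weightedMonomialIdeal ![x, y] ![1, b] k := by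
  refine pow_le_weightedMonomialIdeal_of_span_eq ![x, y] ![1, b] (Fin.forall_fin_two.2 ⟨by simp, by simpa⟩)
    ?_ k
  rw [Matrix.range_cons_cons_empty]

/-- `(x, y) · J_b(n) ⊆ J_b(n+1)` when `b ≥ 1` (each of `x, y` has positive weight). [cite: Wlodarczyk2022, Lemma 2.1.12] -/
theorem span_pair_mul_le (x y : S) {b : ℕ} (hb : 1 ≤ b) (n : ℕ) :
    Ideal.span {x, y} * weightedMonomialIdeal ![x, y] ![1, b] n ≤ weightedMonomialIdeal ![x, y] ![1, b] (n + 1) := by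
  have h1 : Ideal.span {x, y} ≤ weightedMonomialIdeal ![x, y] ![1, b] 1 := by
    simpa using span_pair_pow_le x y hb 1
  rw [Nat.add_comm]
  exact (Ideal.mul_mono_left h1).trans (weightedMonomialIdeal_mul_le ![x, y] ![1, b] 1 n)

/-- **`J_1(n) = (x, y)^n`** (all weights one). [cite: Wlodarczyk2022, Lemma 2.1.12] -/
theorem weightedMonomialIdeal_one_eq_pow (x y : S) (n : ℕ) :
    weightedMonomialIdeal ![x, y] ![1, 1] n = Ideal.span {x, y} ^ n := by
  refine le_antisymm ?_ (span_pair_pow_le x y le_rfl n)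
  rw [weightedMonomialIdeal, Ideal.span_le]
  rintro _ ⟨α, hα, rfl⟩
  simp only [Fin.sum_univ_two, Matrix.cons_val_zero, Matrix.cons_val_one, one_mul] at hα
  rw [Fin.prod_univ_two]
  simp only [Matrix.cons_val_zero, Matrix.cons_val_one, SetLike.mem_coe]
  have hx : x ^ α 0 ∈ Ideal.span {x, y} ^ α 0 := Ideal.pow_mem_pow (Ideal.subset_span (by simp)) _
  have hy : y ^ α 1 ∈ Ideal.span {x, y} ^ α 1 := Ideal.pow_mem_pow (Ideal.subset_span (by simp)) _
  exact Ideal.pow_le_pow_right hα (by rw [pow_add]; exact Ideal.mul_mem_mul hx hy)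

/-- **`J_b(bν) ⊆ (y^ν, x^b)`**: a monomial `x^i y^j` of weight `i + bj ≥ bν` has `j ≥ ν` or `i ≥ b`.
[cite: Wlodarczyk2022, Lemma 2.1.12] -/
theorem weightedMonomialIdeal_le_span_pair (x y : S) (b ν : ℕ) :
    weightedMonomialIdeal ![x, y] ![1, b] (b * ν) ≤ Ideal.span {y ^ ν, x ^ b} := by
  rw [weightedMonomialIdeal, Ideal.span_le]
  rintro _ ⟨α, hα, rfl⟩
  simp only [Fin.sum_univ_two, Matrix.cons_val_zero, Matrix.cons_val_one, one_mul] at hα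
  rw [Fin.prod_univ_two]
  simp only [Matrix.cons_val_zero, Matrix.cons_val_one, SetLike.mem_coe]
  by_cases hj : ν ≤ α 1
  · obtain ⟨d, hd⟩ := Nat.exists_eq_add_of_le hj
    rw [hd, pow_add]
    exact Ideal.mul_mem_left _ _ (Ideal.mul_mem_right _ _ (Ideal.subset_span (by simp)))
  · have hi : b ≤ α 0 := by
      push Not at hj
      have : b * α 1 + b ≤ b * ν := by
        rw [← Nat.mul_succ]
        exact Nat.mul_le_mul_left _ hj
      omega
    obtain ⟨d, hd⟩ := Nat.exists_eq_add_of_le hi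
    rw [hd, pow_add]
    exact Ideal.mul_mem_right _ _ (Ideal.mul_mem_right _ _ (Ideal.subset_span (by simp)))

/-- **`J_b(bν) ⊆ (y^ν) + 𝔪^b`** when `x ∈ 𝔪` — the hypothesis shape of K6
(`LocalGameEFTContact.exists_associated_pow_of_adicSteepening`). [cite: Wlodarczyk2022, Lemma 2.1.12] -/
theorem weightedMonomialIdeal_le_span_sup_pow [IsLocalRing S] {x : S} (hx : x ∈ maximalIdeal S) (y : S)
    (b ν : ℕ) :
    weightedMonomialIdeal ![x, y] ![1, b] (b * ν) ≤ Ideal.span {y ^ ν} ⊔ maximalIdeal S ^ b := by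
  refine (weightedMonomialIdeal_le_span_pair x y b ν).trans ?_
  rw [Ideal.span_insert]
  exact sup_le_sup_left ((Ideal.span_singleton_le_iff_mem _).2 (Ideal.pow_mem_pow hx b)) _

/-- In a regular local ring of dimension two, two generators `x, y` of `𝔪` lie outside `𝔪²`. [cite: Matsumura1987, Thm. 14.2] -/
theorem not_mem_sq_of_span_pair_eq [IsRegularLocalRing S] (hdim : ringKrullDim S = (2 : ℕ)) {x y : S}
    (hxy : Ideal.span {x, y} = maximalIdeal S) :
    x ∉ maximalIdeal S ^ 2 ∧ y ∉ maximalIdeal S ^ 2 := by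
  have hspan : Ideal.span (Set.range ![x, y]) = maximalIdeal S := by
    rw [Matrix.range_cons_cons_empty, hxy]
  have hli := linearIndependent_toCotangent_of_span_eq_maximalIdeal hdim ![x, y] hspan
  have hmem : ∀ i, ![x, y] i ∈ maximalIdeal S := fun i => hspan ▸ Ideal.subset_span ⟨i, rfl⟩
  rw [linearIndependent_toCotangent_iff_forall_mem _ hmem] at hli
  constructor
  · intro hx
    have h := hli ![1, 0] (by simpa [Fin.sum_univ_two] using hx) 0
    simp only [Matrix.cons_val_zero] at h
    exact (IsLocalRing.maximalIdeal.isMaximal S).ne_top (Ideal.eq_top_of_isUnit_mem _ h isUnit_one)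
  · intro hy
    have h := hli ![0, 1] (by simpa [Fin.sum_univ_two] using hy) 1
    simp only [Matrix.cons_val_one] at h
    exact (IsLocalRing.maximalIdeal.isMaximal S).ne_top (Ideal.eq_top_of_isUnit_mem _ h isUnit_one)

/-! ### (K5b) Face extraction -/

/-- **(K5b) Face extraction**: if `f ∈ J_b(bν)` (`b ≥ 1`) then `f ≡ Σ_{j ≤ ν} a_j x^{b(ν-j)} y^j` modulo `J_b(bν+1)`
for some coefficients `a_j ∈ S`. [cite: Wlodarczyk2022, Lemma 2.1.12] -/
theorem exists_face {x y f : S} {b : ℕ} (hb : 1 ≤ b) {ν : ℕ}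
    (hf : f ∈ weightedMonomialIdeal ![x, y] ![1, b] (b * ν)) :
    ∃ a : ℕ → S, f - ∑ j ∈ Finset.range (ν + 1), a j * (x ^ (b * (ν - j)) * y ^ j) ∈
      weightedMonomialIdeal ![x, y] ![1, b] (b * ν + 1) := by
  classical
  rw [weightedMonomialIdeal] at hf
  refine Submodule.span_induction (p := fun z _ => ∃ a : ℕ → S,
      z - ∑ j ∈ Finset.range (ν + 1), a j * (x ^ (b * (ν - j)) * y ^ j) ∈
        weightedMonomialIdeal ![x, y] ![1, b] (b * ν + 1)) ?_ ?_ ?_ ?_ hf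
  · rintro z ⟨α, hα, rfl⟩
    simp only [Fin.sum_univ_two, Matrix.cons_val_zero, Matrix.cons_val_one, one_mul] at hα
    by_cases hgt : b * ν + 1 ≤ α 0 + b * α 1
    · refine ⟨0, ?_⟩
      simp only [Pi.zero_apply, zero_mul, Finset.sum_const_zero, sub_zero]
      exact prod_pow_mem_weightedMonomialIdeal ![x, y] ![1, b] α (by simpa [Fin.sum_univ_two] using hgt)
    · have heq : α 0 + b * α 1 = b * ν := by omega
      have hj : α 1 ≤ ν := by
        by_contra h
        push Not at h
        have : b * ν + b ≤ b * α 1 := by rw [← Nat.mul_succ]; exact Nat.mul_le_mul_left _ h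
        omega
      have h0 : α 0 = b * (ν - α 1) := by
        rw [mul_tsub]
        omega
      refine ⟨Pi.single (α 1) 1, ?_⟩
      rw [Finset.sum_eq_single (α 1) (fun j _ hj' => by rw [Pi.single_eq_of_ne hj', zero_mul])
        (fun h => absurd (Finset.mem_range.2 (Nat.lt_succ_of_le hj)) h), Pi.single_eq_same, one_mul,
        Fin.prod_univ_two]
      simp only [Matrix.cons_val_zero, Matrix.cons_val_one]
      rw [h0, sub_self]
      exact Ideal.zero_mem _
  · exact ⟨0, by simp⟩
  · rintro z₁ z₂ - - ⟨a₁, h₁⟩ ⟨a₂, h₂⟩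
    refine ⟨a₁ + a₂, ?_⟩
    have : z₁ + z₂ - ∑ j ∈ Finset.range (ν + 1), (a₁ + a₂) j * (x ^ (b * (ν - j)) * y ^ j) =
        (z₁ - ∑ j ∈ Finset.range (ν + 1), a₁ j * (x ^ (b * (ν - j)) * y ^ j)) +
          (z₂ - ∑ j ∈ Finset.range (ν + 1), a₂ j * (x ^ (b * (ν - j)) * y ^ j)) := by
      simp only [Pi.add_apply, add_mul, Finset.sum_add_distrib]
      ring
    rw [this]
    exact Ideal.add_mem _ h₁ h₂
  · rintro r z - ⟨a, h⟩
    refine ⟨fun j => r * a j, ?_⟩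
    have : r • z - ∑ j ∈ Finset.range (ν + 1), r * a j * (x ^ (b * (ν - j)) * y ^ j) =
        r * (z - ∑ j ∈ Finset.range (ν + 1), a j * (x ^ (b * (ν - j)) * y ^ j)) := by
      rw [smul_eq_mul, mul_sub, Finset.mul_sum]
      refine congrArg _ (Finset.sum_congr rfl fun j _ => ?_)
      ring
    rw [this]
    exact Ideal.mul_mem_left _ _ h

/-! ### (K5c) Face uniqueness modulo `𝔪` -/

/-- **(K5c) Face uniqueness mod `𝔪`** (weighted quasi-regularity of a regular system of parameters): in a
regular local ring of dimension two with `(x, y) = 𝔪` and `b ≥ 1`, if `Σ_{j ≤ ν} a_j x^{b(ν-j)} y^j ∈ J_b(bν+1)`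
then every `a_j` (`j ≤ ν`) lies in `𝔪`.  Hence the face polynomial `Σ_j ā_j s^j ∈ κ[s]` of `f ∈ J_b(bν)` is well
defined. [cite: Matsumura1987, Thm. 16.2] [cite: Wlodarczyk2022, §2.3.9] -/
theorem face_coeff_mem_maximalIdeal [IsRegularLocalRing S] (hdim : ringKrullDim S = (2 : ℕ)) {x y : S}
    (hxy : Ideal.span {x, y} = maximalIdeal S) {b : ℕ} (hb : 1 ≤ b) {ν : ℕ} (a : ℕ → S)
    (h : ∑ j ∈ Finset.range (ν + 1), a j * (x ^ (b * (ν - j)) * y ^ j) ∈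
      weightedMonomialIdeal ![x, y] ![1, b] (b * ν + 1)) {j : ℕ} (hj : j ≤ ν) :
    a j ∈ maximalIdeal S := by
  classical
  set u : Fin 2 → S := ![x, y] with hu
  set w : Fin 2 → ℕ := ![1, b] with hw
  have hspan : Ideal.span (Set.range u) = maximalIdeal S := by
    rw [hu, Matrix.range_cons_cons_empty, hxy]
  have hmem : ∀ i, u i ∈ maximalIdeal S := fun i => hspan ▸ Ideal.subset_span ⟨i, rfl⟩
  have hli := linearIndependent_toCotangent_of_span_eq_maximalIdeal hdim u hspan
  have hwpos : ∀ i, 0 < w i := Fin.forall_fin_two.2 ⟨by simp [hw], by simpa [hw]⟩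
  -- the face as a weighted form
  let e : ℕ → (Fin 2 →₀ ℕ) := fun j => Finsupp.single 0 (b * (ν - j)) + Finsupp.single 1 j
  let P : MvPolynomial (Fin 2) S := ∑ j ∈ Finset.range (ν + 1), MvPolynomial.monomial (e j) (a j)
  have he1 : ∀ j, e j 1 = j := fun j => by simp [e]
  have he0 : ∀ j, e j 0 = b * (ν - j) := fun j => by simp [e]
  have hweight : ∀ j ∈ Finset.range (ν + 1), Finsupp.weight w (e j) = b * ν := by
    intro j hj'
    have hj' := Nat.lt_succ_iff.1 (Finset.mem_range.1 hj')
    rw [Finsupp.weight_apply, Finsupp.sum_fintype _ _ (fun i => by simp), Fin.sum_univ_two, he0, he1]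
    simp only [hw, Matrix.cons_val_zero, Matrix.cons_val_one, smul_eq_mul, mul_one]
    rw [Nat.mul_comm j b, ← Nat.mul_add, Nat.sub_add_cancel hj']
  have hP : P.IsWeightedHomogeneous w (b * ν) := by
    rw [← MvPolynomial.mem_weightedHomogeneousSubmodule]
    refine Submodule.sum_mem _ fun j hj' => ?_
    rw [MvPolynomial.mem_weightedHomogeneousSubmodule]
    exact MvPolynomial.isWeightedHomogeneous_monomial w (e j) (a j) (hweight j hj')
  have hprod : ∀ j, (e j).prod (fun n k => u n ^ k) = x ^ (b * (ν - j)) * y ^ j := fun j => by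
    show (Finsupp.single (0 : Fin 2) (b * (ν - j)) + Finsupp.single 1 j).prod (fun n k => u n ^ k) = _
    rw [Finsupp.prod_add_index' (fun i => pow_zero _) (fun i m n => pow_add _ _ _),
      Finsupp.prod_single_index (h := fun n k => u n ^ k) (pow_zero _),
      Finsupp.prod_single_index (h := fun n k => u n ^ k) (pow_zero _)]
    simp [hu]
  have heval : MvPolynomial.eval u P = ∑ j ∈ Finset.range (ν + 1), a j * (x ^ (b * (ν - j)) * y ^ j) := by
    simp only [P, map_sum, MvPolynomial.eval_monomial, hprod]
  have hcoeff : P.coeff (e j) = a j := by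
    simp only [P, MvPolynomial.coeff_sum, MvPolynomial.coeff_monomial]
    rw [Finset.sum_eq_single j (fun j' _ hj'ne => if_neg fun h => hj'ne ?_)
      (fun h => absurd (Finset.mem_range.2 (Nat.lt_succ_of_le hj)) h), if_pos rfl]
    have := congrArg (fun d => d 1) h
    simpa [he1] using this
  have key := weightedQuasiRegular_of_linearIndependent_toCotangent u w hwpos hmem hli (b * ν) P hP (by
    rw [← weightedMonomialIdeal_eq_weightedFiltration_ideal, heval]
    exact h) (e j)
  rw [hcoeff, hspan] at key
  exact key

/-! ### (K5d) Steepening kills a `ν`-th-power face -/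

/-- The binomial expansion of the steepened power: `c (y - λ x^b)^ν = Σ_{j ≤ ν} (c·C(ν,j)·(-λ)^{ν-j}) x^{b(ν-j)} y^j`.
[folklore] -/
theorem mul_steepen_pow_eq (x y c lam : S) (b ν : ℕ) :
    c * (y - lam * x ^ b) ^ ν =
      ∑ j ∈ Finset.range (ν + 1), (c * (ν.choose j : S) * (-lam) ^ (ν - j)) * (x ^ (b * (ν - j)) * y ^ j) := by
  rw [sub_eq_add_neg, add_pow, Finset.mul_sum]
  refine Finset.sum_congr rfl fun j _ => ?_
  rw [neg_pow, neg_pow, mul_pow, ← pow_mul]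
  ring

/-- **(K5d) Steepening kills a `ν`-th-power face**: if `f ≡ Σ a_j x^{b(ν-j)} y^j (mod J_b(bν+1))` and the
coefficients agree modulo `𝔪 = (x, y)` with those of `c (s - λ̃)^ν`, then `f ≡ c·(y - λ̃ x^b)^ν (mod J_b(bν+1))`
(`b ≥ 1`; the filtration is the same for `(x, y - λ̃ x^b)` by (K5a)). [cite: Wlodarczyk2022, Lemma 2.1.12] -/
theorem sub_mul_steepen_pow_mem_of_face [IsLocalRing S] {x y f : S} (hxy : Ideal.span {x, y} = maximalIdeal S)
    {b : ℕ} (hb : 1 ≤ b) {ν : ℕ} {a : ℕ → S}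
    (hface : f - ∑ j ∈ Finset.range (ν + 1), a j * (x ^ (b * (ν - j)) * y ^ j) ∈
      weightedMonomialIdeal ![x, y] ![1, b] (b * ν + 1))
    {c lam : S} (hres : ∀ j ∈ Finset.range (ν + 1), a j - c * (ν.choose j : S) * (-lam) ^ (ν - j) ∈ maximalIdeal S) :
    f - c * (y - lam * x ^ b) ^ ν ∈ weightedMonomialIdeal ![x, y] ![1, b] (b * ν + 1) := by
  have hsplit : f - c * (y - lam * x ^ b) ^ ν =
      (f - ∑ j ∈ Finset.range (ν + 1), a j * (x ^ (b * (ν - j)) * y ^ j)) +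
        ∑ j ∈ Finset.range (ν + 1),
          (a j - c * (ν.choose j : S) * (-lam) ^ (ν - j)) * (x ^ (b * (ν - j)) * y ^ j) := by
    rw [mul_steepen_pow_eq]
    simp only [sub_mul, Finset.sum_sub_distrib]
    ring
  rw [hsplit]
  refine Ideal.add_mem _ hface (Ideal.sum_mem _ fun j hj => ?_)
  have hjν : j ≤ ν := Nat.lt_succ_iff.1 (Finset.mem_range.1 hj)
  refine span_pair_mul_le x y hb (b * ν) (Ideal.mul_mem_mul ?_ (faceMonomial_mem x y b ν hjν))
  rw [hxy]
  exact hres j hj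

/-- **(K5d′) Steepening from a residue-field face**: in a local ring with `(x, y) = 𝔪`, if
`f ≡ Σ a_j x^{b(ν-j)} y^j (mod J_b(bν+1))` and the face polynomial is `c̄ (s - λ̄)^ν` over the residue field
(`ā_j = c̄·C(ν,j)·(-λ̄)^{ν-j}`, `c̄ ≠ 0`), then for lifts `c` (a unit), `λ̃` of `c̄, λ̄`:
`f ≡ c (y - λ̃ x^b)^ν (mod J_b(bν+1))`. [cite: Wlodarczyk2022, Lemma 2.1.12] -/
theorem exists_steepen_of_face_eq_pow [IsLocalRing S] {x y f : S} (hxy : Ideal.span {x, y} = maximalIdeal S)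
    {b : ℕ} (hb : 1 ≤ b) {ν : ℕ} {a : ℕ → S}
    (hface : f - ∑ j ∈ Finset.range (ν + 1), a j * (x ^ (b * (ν - j)) * y ^ j) ∈
      weightedMonomialIdeal ![x, y] ![1, b] (b * ν + 1))
    {cbar lbar : ResidueField S} (hc : cbar ≠ 0)
    (hP : ∀ j ∈ Finset.range (ν + 1), residue S (a j) = cbar * (ν.choose j : ResidueField S) * (-lbar) ^ (ν - j)) :
    ∃ c lam : S, IsUnit c ∧ residue S c = cbar ∧ residue S lam = lbar ∧
      f - c * (y - lam * x ^ b) ^ ν ∈ weightedMonomialIdeal ![x, y] ![1, b] (b * ν + 1) := by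
  obtain ⟨c, rfl⟩ := residue_surjective cbar
  obtain ⟨lam, rfl⟩ := residue_surjective lbar
  have hcu : IsUnit c := by
    by_contra h
    exact hc ((residue_eq_zero_iff c).2 ((mem_maximalIdeal _).2 h))
  refine ⟨c, lam, hcu, rfl, rfl, sub_mul_steepen_pow_mem_of_face hxy hb hface fun j hj => ?_⟩
  rw [← residue_eq_zero_iff, map_sub, map_mul, map_mul, map_pow, map_neg, map_natCast, hP j hj, sub_self]

/-- **(K5) START**: a rational `ν`-th-power tangent cone `f ≡ c y^ν (mod 𝔪^{ν+1})` is the level `b = 1` face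
statement `f ≡ c y^ν (mod J_1(ν+1))` (`J_1(n) = 𝔪^n`). [cite: Wlodarczyk2022, Lemma 2.1.12] -/
theorem sub_mem_weightedMonomialIdeal_one_of_sub_mem_pow [IsLocalRing S] {x y f c : S}
    (hxy : Ideal.span {x, y} = maximalIdeal S) {ν : ℕ} (h : f - c * y ^ ν ∈ maximalIdeal S ^ (ν + 1)) :
    f - c * y ^ ν ∈ weightedMonomialIdeal ![x, y] ![1, 1] (1 * ν + 1) := by
  rw [one_mul, weightedMonomialIdeal_one_eq_pow, hxy]
  exact h

/-- **(K5) the face of a pure power**: `f ≡ c y^ν (mod J_b(bν+1))` is the face statement with coefficients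
`a = (0, …, 0, c)`. [folklore] -/
theorem face_of_sub_mul_pow_mem {x y f c : S} {b ν : ℕ}
    (h : f - c * y ^ ν ∈ weightedMonomialIdeal ![x, y] ![1, b] (b * ν + 1)) :
    f - ∑ j ∈ Finset.range (ν + 1), (Pi.single ν c : ℕ → S) j * (x ^ (b * (ν - j)) * y ^ j) ∈
      weightedMonomialIdeal ![x, y] ![1, b] (b * ν + 1) := by
  rw [Finset.sum_eq_single ν (fun j _ hj => by rw [Pi.single_eq_of_ne hj, zero_mul])
    (fun hν => absurd (Finset.self_mem_range_succ ν) hν), Pi.single_eq_same, Nat.sub_self, mul_zero, pow_zero,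
    one_mul]
  exact h

/-! ### Exports in the shapes K7 consumes (res-type-098 07:07:16Z (2)) -/

/-- A prepared level is a level: `f - c y^ν ∈ J_b(bν+1)` implies `f ∈ J_b(bν)` (`y^ν ∈ J_b(bν)`). [folklore] -/
theorem mem_of_sub_mul_pow_mem {x y f c : S} {b ν : ℕ}
    (h : f - c * y ^ ν ∈ weightedMonomialIdeal ![x, y] ![1, b] (b * ν + 1)) :
    f ∈ weightedMonomialIdeal ![x, y] ![1, b] (b * ν) := by
  have hy : c * y ^ ν ∈ weightedMonomialIdeal ![x, y] ![1, b] (b * ν) := by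
    refine Ideal.mul_mem_left _ _ ?_
    simpa [Nat.mul_comm] using pow_mem_weightedMonomialIdeal ![x, y] ![1, b] (snd_mem x y b) ν
  simpa using Ideal.add_mem _ (weightedMonomialIdeal_antitone _ _ (Nat.le_succ _) h) hy

/-- **Case C package** (the literal triple res-type-098's K7 consumes for kernel K3): from a prepared level `b` —
`f ≡ c y^ν (mod J_b(bν+1))` with `c` a unit — which is NOT a level `b+1`, read off
`f ∈ J_b(bν) ∧ (∃ c unit, f - c y^ν ∈ J_b(bν+1)) ∧ f ∉ J_{b+1}((b+1)ν)` (first Newton slope `β*` with `⌊β*⌋ = b`,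
`β* ∉ ℤ`). [folklore] -/
theorem caseC_package {x y f c : S} {b ν : ℕ} (hc : IsUnit c)
    (hprep : f - c * y ^ ν ∈ weightedMonomialIdeal ![x, y] ![1, b] (b * ν + 1))
    (hnext : f ∉ weightedMonomialIdeal ![x, y] ![1, b + 1] ((b + 1) * ν)) :
    f ∈ weightedMonomialIdeal ![x, y] ![1, b] (b * ν) ∧
      (∃ c : S, IsUnit c ∧ f - c * y ^ ν ∈ weightedMonomialIdeal ![x, y] ![1, b] (b * ν + 1)) ∧
      f ∉ weightedMonomialIdeal ![x, y] ![1, b + 1] ((b + 1) * ν) :=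
  ⟨mem_of_sub_mul_pow_mem hprep, ⟨c, hc, hprep⟩, hnext⟩

/-- The steepening step in K6's hypothesis shape: `(y - c x^b) - y ∈ (x^b)`. [folklore] -/
theorem steepen_sub_mem (x y c : S) (b : ℕ) : (y - c * x ^ b) - y ∈ Ideal.span {x ^ b} :=
  Ideal.mem_span_singleton'.mpr ⟨-c, by ring⟩

end LocalGameEFTSteepening

end Summit.ResolutionOfSingularities.ResolutionOfSingularities.Theorems

end
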